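import Summits.Ventures.QEC.Census.CertCheck
import HarnessLib

/-!
# Distance certificate DATA for the census row `2bga-g30-A0.1.3.10-B0.1.3.22` (family GB) as `TB_g30_A0_1_3_10_B0_1_3_22.cert` — emitted by qec-type-07 (07.MITMK)

Source certificate: `cert/search-8/j265978/2bga-g30-A0.1.3.10-B0.1.3.22.certA.json` — kernel A, id (sha256) `1ec12cdc203463e2433a59c1206ea76df2c081a1ebfc41c430c4b8493990619e` (`certA=1ec12cdc203463e2`),
lower-bound methods bz (Z) / bz (X) as RUN BY KERNEL A; here only its matrices,
upper witnesses and allow-lists are data — the lower bound is RE-ESTABLISHED in the kernel by the meet-in-the-middle lane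
`Census/CertMitmK.lean` (sibling files `MitmKZ*.lean` — Z side; the X side by the kernel X↔Z swap of `Census/CertCheckXZSwap.lean`), the row theorem is `GB/TB_g30_A0_1_3_10_B0_1_3_22/Distance.lean`.
Code: n = 60, 30 X-checks, 30 Z-checks; construction {"type": "explicit"}; generators
`/work/gens/q/2bga-g30-A0.1.3.10-B0.1.3.22.json` (matrix_sha256 `50b54ae395451560e4f9e2d89934d4d9490662d1d398ba747491baf3a79b6c28`); claimed (n, k, dZ, dX) =
(60, 8, 8, 8) — a CLAIM of the certificate until the sibling theorems;
printed/third-party value: none — a census-discovered code (no parameters for it are claimed in print; any TABLE `d_printed` entry is a census/third-method comparator, wording qec-lead's).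
Allow-lists (`found`): side Z: the certificate's 0 words verbatim; side X: the certificate's list verbatim (not used: the X side follows by the kernel X↔Z swap, `Distance.lean`).
Format = qec-search-7's `emit_lean.py` (`Census/<F>/<Code>/Cert.lean` convention: supports as binary numerals, bit `j` =
qubit `j` of the gens file, identity layout). This file is DATA: no theorem, no `decide`. Generated 2026-08-27T12:36Z by
HOME/census/type-07/emit_mitmk.py; do not edit by hand — re-emit.
-/

namespace Summit.Ventures.QEC.Census.TB_g30_A0_1_3_10_B0_1_3_22

/-- The distance certificate of `TB_g30_A0_1_3_10_B0_1_3_22` as a `DistCert` literal (CERT-FORMAT v1 kernel fields; certificate id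
`1ec12cdc203463e2`): `n = 60`, `HX`/`HZ` = the 30 + 30 check rows (words as binary numerals (bit `j` = qubit `j`)), side Z =
(d := 8, weight-8 Z-logical witness, its non-membership witness, allow-list of 0 stabilizer words with
their row decompositions), side X likewise (d := 8, 0 words). -/
def cert : DistCert where
  n := 60
  HX := [
    4503611438531595, 9007222877063190, 18014445754126380, 36028891508252760, 72057783016505520, 144115566033011040,
    288231132066022080, 576462264132044160, 3024730983168, 6049461966336, 12098923932672, 24197847865344,
    48395695730688, 96791391461376, 193582782922752, 387165565845504, 774331131691008, 1548662263382016,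
    3097324526764032, 6194649053528064, 12389297033314305, 24778594066628610, 49557188133257220, 99114376266514440,
    198228752533028880, 396457505066057760, 792915010132115520, 432908515657384065, 865817031314768130, 578712558022689285]
  HZ := [
    721701842030952705, 290482179455058435, 580964358910116870, 9007213213386765, 18014426426773530, 36028852853547060,
    72057705707094120, 144115411414188240, 288230822828376480, 576461645656752960, 1787780400768, 3575560801536,
    7151121603072, 14302243206144, 28604486412288, 57208972824576, 114417945649152, 228835891298304,
    457671782596608, 915343565193216, 1830687130386432, 3661374260772864, 7322747447803905, 14645494895607810,
    29290989791215620, 58581979582431240, 117163959164862480, 234327918329724960, 468655836659449920, 937311673318899840]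
  sideZ := { d := 8, witness := 4962096047457280, nonmember := 204021800723,
             found := [] }
  sideX := { d := 8, witness := 4588098834433, nonmember := 119304647,
             found := [] }

end Summit.Ventures.QEC.Census.TB_g30_A0_1_3_10_B0_1_3_22
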